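import Mathlib
import Literature.Computation.Certificates.LieDerivative
import HarnessLib

/-!
# `BarrierStepRungThree`, LINE g2-2: calculus of kernel-checkable sparse polynomials (`SOS.Poly`)
composed with a linear coordinate map — the adapter between `sdp2lean` certificates and the
clock/barrier clauses of `WindowCertificateMargin` / K2″

The rational SOS certificates that the line's instrument (speedrun build `sdp2lean`; soundness in
`Literature/Computation/Certificates/{SumOfSquares,GramSOS,LieDerivative}.lean`) produces are
theorems `∀ y : ℕ → ℝ, (∀ g ∈ gs, 0 ≤ g.eval y) → 0 ≤ p.eval y` about SPARSE RATIONAL POLYNOMIALS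
`SOS.Poly` (lists of `(exponent vector, coefficient)`), evaluated at points `y : ℕ → ℝ`. The
certificate clauses of this route (items stmt-NavierStokesRegularity-23648 / -23942 and the repaired
format K2″ of `BarrierSoundness.barrierSoundness₃`) speak of a `C¹` clock `v : E → ℝ` on the window
space `E = (Fin 4 → Fin n → ℝ)`, its Fréchet derivative `fderiv ℝ v x` applied to the window vector
field, and the operator norm `‖fderiv ℝ v x‖` (sup norm on `E`). This file is the table-free bridge:
for any continuous linear COORDINATE MAP `L : E →L[ℝ] (ℕ → ℝ)` and any `P : SOS.Poly`, the function
`v x := P.eval (L x)`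

* is `C^m` for every `m` (`contDiff_eval_comp`), in particular `C¹` and continuous;
* has Fréchet derivative given by the kernel-computable partial derivatives `SOS.Poly.pderiv`:
  `fderiv ℝ v x w = Σ_{k < numVars P} (∂ₖP)(L x) · (L w) k` (`fderiv_eval_comp_apply`; via the
  tree's chain rule `SOS.Poly.hasDerivWithinAt_eval` along the line `τ ↦ x + τ • w` and
  `DifferentiableAt.lineDeriv_eq_fderiv`);
* hence `fderiv ℝ v x w = (lieDeriv F P)(L x)` whenever the direction's coordinates are the values
  of a polynomial field `F` at `L x` (`fderiv_eval_comp_apply_eq_eval_lieDeriv`) — so an `sdp2lean`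
  theorem `0 ≤ (−lieDeriv F P − 2γ)(y)` on the region IS the undisturbed decrease clause;
* has `‖fderiv ℝ v x‖ ≤ Σ_{k < numVars P} |(∂ₖP)(L x)| · ‖πₖ ∘ L‖` (`opNorm_fderiv_eval_comp_le`),
  which with unit-norm coordinates gives the `Λ`-clause from a bound on `Σ |∂ₖP|` over `{v ≤ 0}`.

Finally `exists_windowCoordinates` supplies, for the window space `Fin 4 → Fin n → ℝ`, a coordinate
map `L` with `L x (4j + i) = x i j`, `L x k = 0` for `k ≥ 4n`, and coordinate norms `≤ 1` (sup
norm), as an EXISTENCE statement (no new definition), to be `obtain`ed inside a certificate proof.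

HONEST FRAMING: generic real-analysis plumbing for the certificate FORMAT of a line on class rung
TL-M3 (MODEL lattice tables); it proves no certificate, nothing about any table, and nothing about
the Navier–Stokes equations. Statement shapes: Rouche–Habets–Laloy 1977 Ch. I §3.1 (V̇ = (∂V/∂x | f));
Blekherman–Parrilo–Thomas 2012 §3.1 (SOS data format), as in the cited tree modules.
-/

noncomputable section

-- the sub-problem namespace `Summit.NavierStokesRegularity.NavierStokesRegularity` repeats the summit name by design (D-0017)
set_option linter.dupNamespace false

namespace Summit.NavierStokesRegularity.NavierStokesRegularity.Theorems

namespace SOSPolyCalculus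

open Finset
open Literature.Computation.Certificates Literature.Computation.Certificates.SOS
open Literature.Computation.Certificates.SOS.Poly Literature.Computation.Certificates.SOS.Monomial

variable {E : Type*} [NormedAddCommGroup E] [NormedSpace ℝ E]

/-! ### Smoothness of `x ↦ P(L x)` -/

/-- Each coordinate `x ↦ (L x) k` of a continuous linear coordinate map is a continuous linear
functional, hence `C^m`. [folklore] -/
theorem contDiff_coord (L : E →L[ℝ] (ℕ → ℝ)) (k : ℕ) {m : WithTop ℕ∞} :
    ContDiff ℝ m (fun x => L x k) :=
  ((ContinuousLinearMap.proj (R := ℝ) (φ := fun _ : ℕ => ℝ) k).comp L).contDiff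

/-- A monomial read from any start index is `C^m` along a linear coordinate map (finite product of
powers of coordinates). [folklore] -/
theorem contDiff_monomial_evalFrom (L : E →L[ℝ] (ℕ → ℝ)) {m : WithTop ℕ∞} :
    ∀ (mo : Monomial) (k₀ : ℕ), ContDiff ℝ m (fun x => (Monomial.evalFrom (L x) k₀ mo : ℝ))
  | [], k₀ => by simpa using contDiff_const
  | e :: es, k₀ => by
      simpa using ((contDiff_coord L k₀).pow e).mul (contDiff_monomial_evalFrom L es (k₀ + 1))

/-- **`x ↦ P(L x)` is `C^m` for every `m`** (finite sum of rational multiples of monomials).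
This discharges the clause `ContDiff ℝ 1 v` (and, with `m = 0`, `Continuous g`) for clocks and
goal functions given as `sdp2lean` polynomials. [folklore] -/
theorem contDiff_eval_comp (L : E →L[ℝ] (ℕ → ℝ)) {m : WithTop ℕ∞} :
    ∀ P : Poly, ContDiff ℝ m (fun x => (Poly.eval (L x) P : ℝ))
  | [] => by simpa using contDiff_const
  | (mo, c) :: P => by
      simpa using (contDiff_const.mul (contDiff_monomial_evalFrom L mo 0)).add (contDiff_eval_comp L P)

/-- `x ↦ P(L x)` is continuous. [folklore] -/
theorem continuous_eval_comp (L : E →L[ℝ] (ℕ → ℝ)) (P : Poly) :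
    Continuous (fun x => (Poly.eval (L x) P : ℝ)) :=
  (contDiff_eval_comp L (m := 0) P).continuous

/-- `x ↦ P(L x)` is differentiable. [folklore] -/
theorem differentiable_eval_comp (L : E →L[ℝ] (ℕ → ℝ)) (P : Poly) :
    Differentiable ℝ (fun x => (Poly.eval (L x) P : ℝ)) :=
  (contDiff_eval_comp L (m := 1) P).differentiable (by simp)

/-! ### Evaluation of the kernel partial derivative `SOS.Poly.pderiv` -/

/-- Exponents vanish beyond the length of the exponent vector. [folklore] -/
theorem expAt_eq_zero_of_length_le : ∀ (m : Monomial) (j : ℕ), m.length ≤ j → expAt m j = 0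
  | [], _, _ => rfl
  | _ :: _, 0, h => by simp at h
  | _ :: es, j + 1, h => expAt_eq_zero_of_length_le es j (by simpa using h)

/-- `eval` of the partial derivative of one more term: the term `c·x^m` contributes
`c · m_k · x^(m − e_k)` (which is `0` when `m_k = 0`, the case in which `pderiv` drops it). [folklore] -/
theorem eval_pderiv_cons (y : ℕ → ℝ) (k : ℕ) (m : Monomial) (c : ℚ) (P : Poly) :
    (Poly.eval y (pderiv k ((m, c) :: P)) : ℝ) =
      (c : ℝ) * (expAt m k : ℝ) * Monomial.eval y (dec k m) + Poly.eval y (pderiv k P) := by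
  unfold pderiv
  rw [List.filterMap_cons]
  split_ifs with h
  · simp [h]
  · rw [Poly.eval_cons]
    push_cast
    ring

/-- `derivAlong g y P` (the chain-rule derivative of `SOS.Poly.hasDerivWithinAt_eval`) equals
`Σ_{k < K} (∂ₖP)(y) · g k` for every `K ≥ numVars P`. [folklore] -/
theorem derivAlong_eq_sum_pderiv (g : ℕ → ℝ) (y : ℕ → ℝ) :
    ∀ (P : Poly) (K : ℕ), numVars P ≤ K →
      derivAlong g y P = ∑ k ∈ range K, (Poly.eval y (pderiv k P) : ℝ) * g k
  | [], K, _ => by simp [derivAlong, pderiv]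
  | (m, c) :: P, K, hK => by
      have hm : m.length ≤ K := (le_max_left _ _).trans hK
      have hP : numVars P ≤ K := (le_max_right _ _).trans hK
      rw [derivAlong, derivAlong_eq_sum_pderiv g y P K hP]
      simp_rw [eval_pderiv_cons, add_mul, sum_add_distrib]
      congr 1
      -- the one-term sum over `j < |m|` is the sum over `k < K` (exponents vanish beyond `|m|`)
      rw [mul_sum]
      rw [← sum_subset (range_subset_range.2 hm) (fun j _ hj => by
        have hj' : m.length ≤ j := by simpa using hj
        rw [expAt_eq_zero_of_length_le m j hj']
        simp)]
      refine sum_congr rfl fun j _ => ?_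
      simp only [Monomial.eval_eq]
      ring

/-! ### The derivative: `fderiv v x w = Σₖ (∂ₖP)(L x) · (L w)ₖ` -/

/-- **Chain rule along a line.** `τ ↦ P(L(x + τ•w))` has derivative
`Σ_{k < numVars P} (∂ₖP)(L(x + τ•w)) · (L w) k` at every `τ`.
[cite: RoucheHabetsLaloy1977, Ch. I §3.1 eq. (3.1); tree `SOS.Poly.hasDerivWithinAt_eval`] -/
theorem hasDerivAt_eval_comp_line (L : E →L[ℝ] (ℕ → ℝ)) (P : Poly) (x w : E) (t : ℝ) :
    HasDerivAt (fun τ : ℝ => (Poly.eval (L (x + τ • w)) P : ℝ))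
      (∑ k ∈ range (numVars P), (Poly.eval (L (x + t • w)) (pderiv k P) : ℝ) * L w k) t := by
  have hz : ∀ k, HasDerivAt (fun τ : ℝ => L (x + τ • w) k) (L w k) t := by
    intro k
    have h1 : HasDerivAt (fun τ : ℝ => x + τ • w) w t := by
      simpa using ((hasDerivAt_id t).smul_const w).const_add x
    exact (((ContinuousLinearMap.proj (R := ℝ) (φ := fun _ : ℕ => ℝ) k).comp L).hasFDerivAt
      (x := x + t • w)).comp_hasDerivAt t h1
  have hmain := (SOS.Poly.hasDerivWithinAt_eval (z := fun τ => L (x + τ • w)) (g := fun k => L w k)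
    (s := Set.univ) (t := t) (fun k => (hz k).hasDerivWithinAt)) P
  rw [hasDerivWithinAt_univ] at hmain
  refine hmain.congr_deriv ?_
  exact derivAlong_eq_sum_pderiv (fun k => L w k) (L (x + t • w)) P (numVars P) le_rfl

/-- **The Fréchet derivative of `v = P ∘ L` applied to a direction `w`** is the kernel-computable
pairing `Σ_{k < numVars P} (∂ₖP)(L x) · (L w) k`. [folklore] -/
theorem fderiv_eval_comp_apply (L : E →L[ℝ] (ℕ → ℝ)) (P : Poly) (x w : E) :
    fderiv ℝ (fun x => (Poly.eval (L x) P : ℝ)) x w =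
      ∑ k ∈ range (numVars P), (Poly.eval (L x) (pderiv k P) : ℝ) * L w k := by
  rw [← (differentiable_eval_comp L P x).lineDeriv_eq_fderiv, lineDeriv,
    (hasDerivAt_eval_comp_line L P x w 0).deriv]
  simp

/-- The same with the sum over any `K ≥ numVars P` (terms beyond `numVars` vanish). [folklore] -/
theorem fderiv_eval_comp_apply_of_le (L : E →L[ℝ] (ℕ → ℝ)) (P : Poly) (x w : E) {K : ℕ}
    (hK : numVars P ≤ K) :
    fderiv ℝ (fun x => (Poly.eval (L x) P : ℝ)) x w =
      ∑ k ∈ range K, (Poly.eval (L x) (pderiv k P) : ℝ) * L w k := by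
  rw [fderiv_eval_comp_apply]
  -- `derivAlong` at both bounds
  rw [← derivAlong_eq_sum_pderiv (fun k => L w k) (L x) P (numVars P) le_rfl,
    derivAlong_eq_sum_pderiv (fun k => L w k) (L x) P K hK]

/-- `HasFDerivAt` form (the function is `C¹`). [folklore] -/
theorem hasFDerivAt_eval_comp (L : E →L[ℝ] (ℕ → ℝ)) (P : Poly) (x : E) :
    HasFDerivAt (fun x => (Poly.eval (L x) P : ℝ)) (fderiv ℝ (fun x => (Poly.eval (L x) P : ℝ)) x) x :=
  (differentiable_eval_comp L P x).hasFDerivAt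

/-- **Decrease clause adapter.** If the direction `w` has coordinates `(L w) k = F_k(L x)` for the
polynomial field `F` (components beyond the list read `0`) at every `k < numVars P`, then
`fderiv v x w` is the value of the kernel-computed Lie derivative `lieDeriv F P` at `L x`; so an
`sdp2lean` bound on `−lieDeriv F P` over the region is exactly the undisturbed decrease clause.
[cite: RoucheHabetsLaloy1977, Ch. I §3.1 eq. (3.1)] -/
theorem fderiv_eval_comp_apply_eq_eval_lieDeriv (L : E →L[ℝ] (ℕ → ℝ)) (P : Poly) (F : List Poly)
    (x w : E) (hw : ∀ k < numVars P, L w k = (Poly.eval (L x) (F.getD k []) : ℝ)) :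
    fderiv ℝ (fun x => (Poly.eval (L x) P : ℝ)) x w = Poly.eval (L x) (lieDeriv F P) := by
  rw [fderiv_eval_comp_apply, eval_lieDeriv]
  exact sum_congr rfl fun k hk => by rw [hw k (by simpa using hk)]

/-! ### The operator norm of the derivative -/

/-- The Fréchet derivative as a finite combination of the coordinate functionals `πₖ ∘ L`.
[folklore] -/
theorem fderiv_eval_comp_eq_sum (L : E →L[ℝ] (ℕ → ℝ)) (P : Poly) (x : E) :
    fderiv ℝ (fun x => (Poly.eval (L x) P : ℝ)) x =
      ∑ k ∈ range (numVars P), (Poly.eval (L x) (pderiv k P) : ℝ) •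
        ((ContinuousLinearMap.proj (R := ℝ) (φ := fun _ : ℕ => ℝ) k).comp L) := by
  ext w
  rw [fderiv_eval_comp_apply]
  simp

/-- **`Λ`-clause adapter**: `‖fderiv v x‖ ≤ Σ_{k < numVars P} |(∂ₖP)(L x)| · ‖πₖ ∘ L‖`. [folklore] -/
theorem opNorm_fderiv_eval_comp_le (L : E →L[ℝ] (ℕ → ℝ)) (P : Poly) (x : E) :
    ‖fderiv ℝ (fun x => (Poly.eval (L x) P : ℝ)) x‖ ≤
      ∑ k ∈ range (numVars P), |(Poly.eval (L x) (pderiv k P) : ℝ)| *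
        ‖(ContinuousLinearMap.proj (R := ℝ) (φ := fun _ : ℕ => ℝ) k).comp L‖ := by
  rw [fderiv_eval_comp_eq_sum]
  refine (norm_sum_le _ _).trans (sum_le_sum fun k _ => ?_)
  rw [norm_smul, Real.norm_eq_abs]

/-- With unit-norm coordinates (`‖πₖ ∘ L‖ ≤ 1`, e.g. sup-norm coordinates of a product space),
`‖fderiv v x‖ ≤ Σ_{k < numVars P} |(∂ₖP)(L x)|`. [folklore] -/
theorem opNorm_fderiv_eval_comp_le_sum_abs (L : E →L[ℝ] (ℕ → ℝ))
    (hL : ∀ k, ‖(ContinuousLinearMap.proj (R := ℝ) (φ := fun _ : ℕ => ℝ) k).comp L‖ ≤ 1)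
    (P : Poly) (x : E) :
    ‖fderiv ℝ (fun x => (Poly.eval (L x) P : ℝ)) x‖ ≤
      ∑ k ∈ range (numVars P), |(Poly.eval (L x) (pderiv k P) : ℝ)| :=
  (opNorm_fderiv_eval_comp_le L P x).trans
    (sum_le_sum fun k _ => by
      simpa using mul_le_mul_of_nonneg_left (hL k) (abs_nonneg (Poly.eval (L x) (pderiv k P) : ℝ)))

/-! ### Window coordinates for `Fin 4 → Fin n → ℝ` -/

/-- **Window coordinates.** On the window space `Fin 4 → Fin n → ℝ` (sup norm) there is a
continuous linear coordinate map `L` into `ℕ → ℝ` reading the mode-`i`, shell-`j` coordinate at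
index `4j + i`, vanishing from index `4n` on, with every coordinate functional of norm `≤ 1`.
(Existence only — certificate files `obtain` it; the variable order `k = 4j + i` is the one to use
when exporting the window polynomials to `sdp2lean`.) [folklore] -/
theorem exists_windowCoordinates (n : ℕ) :
    ∃ L : (Fin 4 → Fin n → ℝ) →L[ℝ] (ℕ → ℝ),
      (∀ (x : Fin 4 → Fin n → ℝ) (i : Fin 4) (j : Fin n), L x (4 * (j : ℕ) + (i : ℕ)) = x i j) ∧
      (∀ (x : Fin 4 → Fin n → ℝ) (k : ℕ), 4 * n ≤ k → L x k = 0) ∧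
      (∀ k : ℕ, ‖(ContinuousLinearMap.proj (R := ℝ) (φ := fun _ : ℕ => ℝ) k).comp L‖ ≤ 1) := by
  classical
  -- coordinate functional number `k`
  let π : ℕ → ((Fin 4 → Fin n → ℝ) →L[ℝ] ℝ) := fun k =>
    if h : k < 4 * n then
      (ContinuousLinearMap.proj (R := ℝ) (φ := fun _ : Fin n => ℝ) (⟨k / 4, by omega⟩ : Fin n)).comp
        (ContinuousLinearMap.proj (R := ℝ) (φ := fun _ : Fin 4 => Fin n → ℝ) (⟨k % 4, by omega⟩ : Fin 4))
    else 0
  refine ⟨ContinuousLinearMap.pi π, ?_, ?_, ?_⟩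
  · intro x i j
    have hk : 4 * (j : ℕ) + (i : ℕ) < 4 * n := by omega
    have hdiv : (4 * (j : ℕ) + (i : ℕ)) / 4 = (j : ℕ) := by omega
    have hmod : (4 * (j : ℕ) + (i : ℕ)) % 4 = (i : ℕ) := by omega
    simp only [ContinuousLinearMap.pi_apply, π, dif_pos hk, ContinuousLinearMap.comp_apply,
      ContinuousLinearMap.proj_apply]
    simp [hmod, hdiv]
  · intro x k hk
    have hk' : ¬ k < 4 * n := by omega
    simp [π, dif_neg hk']
  · intro k
    refine ContinuousLinearMap.opNorm_le_bound _ zero_le_one fun x => ?_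
    rw [one_mul]
    simp only [ContinuousLinearMap.comp_apply, ContinuousLinearMap.proj_apply,
      ContinuousLinearMap.pi_apply, π]
    split_ifs with h
    · simp only [ContinuousLinearMap.comp_apply, ContinuousLinearMap.proj_apply]
      exact (norm_le_pi_norm (x (⟨k % 4, by omega⟩ : Fin 4)) _).trans (norm_le_pi_norm x _)
    · simp

end SOSPolyCalculus

end Summit.NavierStokesRegularity.NavierStokesRegularity.Theorems
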